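import Mathlib
import Summits.QuantumFields.YangMills.Theorems.AdjointLoopFanoAdjDevLipschitz
import Summits.QuantumFields.YangMills.Theorems.AdjointLoopFanoDirichletPrelim
import Summits.QuantumFields.YangMills.Theorems.FemtoTransferGapSlabFlowLift
import HarnessLib

/-!
# The KINEMATIC Dirichlet chain for the adjoint Polyakov loop (support for `AdjointLoopFano.AdjointLoopDirichlet`, stmt-QuantumFields-23322)

Route `AdjointLoopFano` (LINE g16-B of seat ym-idea-4).  With `F = flowLift 0 d`, `d(u) = 4 − (Re tr u(e₀))²`, and a non-negative physical
exact ground state `Ω` (`K_βΩ = λ₀Ω`), the one-step deficit `D₁(F) = λ₀‖FΩ‖² − ⟨FΩ,K_β(FΩ)⟩` is bounded by WEIGHTED TEMPORAL PLAQUETTE MEANS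
in the vacuum pair measure, with no analytic input:

  ★ `deficit_adjLoop_le_weighted_plaquettes`:
    `D₁(F) ≤ (2L/|Λ|) Σ_x Σ_{j<L} ∫∫ Ω(U)K_β(U,V)Ω(V) · (d_x(U) + d_x(V)) · (4 − 2Re tr U_{x_j}V_{x_j}⁻¹)`,
  `d_x = flowLiftAt x 0 d` (the deviation of the Polyakov loop through `x`), `x_j = x + j e₀` its links, `|Λ| = L³` sites.

Chain: `deficit_eq_half_integral_sq` (exact Dirichlet identity) → Jensen over the sites `(ΔF)² ≤ |Λ|⁻¹Σ_x(Δd_x)²` → the relative Lipschitz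
bound `adjDev_sub_sq_le` `(Δd_x)² ≤ 4(d_x(U)+d_x(V))‖ΔP_x‖_F²` → telescoping of the Polyakov product over its `L` unitary factors
`‖ΔP_x‖_F ≤ Σ_j ‖U_{x_j} − V_{x_j}‖_F` and Cauchy–Schwarz `(Σ_j)² ≤ L Σ_j`, `‖U_ℓ − V_ℓ‖_F² = 4 − 2Re tr(U_ℓV_ℓ⁻¹)`.
As recorded in the prover memo on the item (evidence #2), feeding a weighted plaquette mean `≤ η` per link into ★ gives
`D₁(F) ≤ 4L²η·λ₀E_Ω[F]` — a factor `L³` short of the item's `1/L`, which therefore encodes decorrelation of the link increments (not kinematic).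

HONEST FRAMING: kinematic bookkeeping; the crux is OPEN; K2a, R2ξ″ and the YM mass gap are NOT proved.  No `sorry`, no new axiom, no new
definition.  References: [cite: ReedSimonIV1978, Thm. XIII.1]; [cite: Luscher1983, §2]; [cite: HornJohnson2013, (0.2.5)].
-/

set_option autoImplicit false

noncomputable section

open MeasureTheory Filter Topology Real
open scoped Matrix ComplexConjugate BigOperators
open Literature.MathematicalPhysics.QuantumFieldTheory (GaugeConfig Site Edge gaugeTransform wilsonFlow wilsonFlow_zero lineHolonomy
  frobNorm frobNorm_nonneg frobNorm_sub_le frobNorm_unitary_mul frobNorm_mul_unitary frobNorm_zero)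
open Literature.MathematicalPhysics.QuantumLattice (fundamentalRep_apply secondCountableTopology_su2)

namespace Summit.QuantumFields.YangMills.Theorems.AdjointLoopFano

open Summit.QuantumFields.YangMills.Theorems.FemtoTransferGap

variable {L : ℕ} [NeZero L]

/-! ## §1 Telescoping of a line holonomy over its unitary factors -/

omit [NeZero L] in
/-- **Telescoping**: `‖P_n(U; y) − P_n(V; y)‖_F ≤ Σ_{j<n} ‖U(y_j, k) − V(y_j, k)‖_F`, `y_j = y + j e_k` (unitary factors).
[cite: HornJohnson2013, (0.2.5)] -/
theorem frobNorm_lineHolonomy_sub_le (U V : GaugeConfig 3 L SU2) (k : Fin 3) :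
    ∀ (n : ℕ) (y : Site 3 L),
      frobNorm (((lineHolonomy U k n y : SU2) : Matrix (Fin 2) (Fin 2) ℂ) - ((lineHolonomy V k n y : SU2) : Matrix (Fin 2) (Fin 2) ℂ)) ≤
        ∑ j ∈ Finset.range n,
          frobNorm (((U ((fun z : Site 3 L => z.shift k)^[j] y, k) : SU2) : Matrix (Fin 2) (Fin 2) ℂ) -
            ((V ((fun z : Site 3 L => z.shift k)^[j] y, k) : SU2) : Matrix (Fin 2) (Fin 2) ℂ))
  | 0, y => by simp [lineHolonomy, frobNorm_zero]
  | n + 1, y => by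
    have ih := frobNorm_lineHolonomy_sub_le U V k n (y.shift k)
    rw [Finset.sum_range_succ']
    simp only [Function.iterate_succ_apply, Function.iterate_zero, id_eq]
    -- `‖aP − bQ‖ ≤ ‖a(P − Q)‖ + ‖(a − b)Q‖ = ‖P − Q‖ + ‖a − b‖`
    set a : Matrix (Fin 2) (Fin 2) ℂ := ((U (y, k) : SU2) : Matrix (Fin 2) (Fin 2) ℂ) with ha
    set b : Matrix (Fin 2) (Fin 2) ℂ := ((V (y, k) : SU2) : Matrix (Fin 2) (Fin 2) ℂ) with hb
    set P : Matrix (Fin 2) (Fin 2) ℂ := ((lineHolonomy U k n (y.shift k) : SU2) : Matrix (Fin 2) (Fin 2) ℂ) with hP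
    set Q : Matrix (Fin 2) (Fin 2) ℂ := ((lineHolonomy V k n (y.shift k) : SU2) : Matrix (Fin 2) (Fin 2) ℂ) with hQ
    have hU1 : ((lineHolonomy U k (n + 1) y : SU2) : Matrix (Fin 2) (Fin 2) ℂ) = a * P := by
      rw [lineHolonomy, Submonoid.coe_mul]
    have hV1 : ((lineHolonomy V k (n + 1) y : SU2) : Matrix (Fin 2) (Fin 2) ℂ) = b * Q := by
      rw [lineHolonomy, Submonoid.coe_mul]
    rw [hU1, hV1]
    have h1 : frobNorm (a * P - b * Q) ≤ frobNorm (a * P - a * Q) + frobNorm (a * Q - b * Q) := frobNorm_sub_le _ _ _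
    have h2 : frobNorm (a * P - a * Q) = frobNorm (P - Q) := by
      rw [← Matrix.mul_sub, frobNorm_unitary_mul (su2_mem_unitaryGroup (U (y, k)))]
    have h3 : frobNorm (a * Q - b * Q) = frobNorm (a - b) := by
      rw [← Matrix.sub_mul, frobNorm_mul_unitary _ (su2_mem_unitaryGroup (lineHolonomy V k n (y.shift k)))]
    rw [h2, h3] at h1
    linarith

omit [NeZero L] in
/-- Squared form with Cauchy–Schwarz: `‖P_n(U;y) − P_n(V;y)‖_F² ≤ n · Σ_{j<n} (4 − 2Re tr(U(y_j,k) V(y_j,k)⁻¹))`. [cite: HornJohnson2013, (0.2.5)] -/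
theorem frobNorm_lineHolonomy_sub_sq_le (U V : GaugeConfig 3 L SU2) (k : Fin 3) (n : ℕ) (y : Site 3 L) :
    frobNorm (((lineHolonomy U k n y : SU2) : Matrix (Fin 2) (Fin 2) ℂ) - ((lineHolonomy V k n y : SU2) : Matrix (Fin 2) (Fin 2) ℂ)) ^ 2 ≤
      n * ∑ j ∈ Finset.range n,
        (4 - 2 * (((U ((fun z : Site 3 L => z.shift k)^[j] y, k) * (V ((fun z : Site 3 L => z.shift k)^[j] y, k))⁻¹ : SU2) :
          Matrix (Fin 2) (Fin 2) ℂ).trace.re)) := by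
  have h1 := frobNorm_lineHolonomy_sub_le U V k n y
  have h0 : 0 ≤ frobNorm (((lineHolonomy U k n y : SU2) : Matrix (Fin 2) (Fin 2) ℂ) -
      ((lineHolonomy V k n y : SU2) : Matrix (Fin 2) (Fin 2) ℂ)) := frobNorm_nonneg _
  have h2 := pow_le_pow_left₀ h0 h1 2
  refine h2.trans ?_
  refine (sq_sum_le_card_mul_sum_sq).trans ?_
  rw [Finset.card_range]
  refine mul_le_mul_of_nonneg_left (le_of_eq ?_) (Nat.cast_nonneg _)
  refine Finset.sum_congr rfl fun j _ => ?_
  rw [frobNorm_sub_sq_eq]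

/-! ## §2 The pointwise bound on `(F(U) − F(V))²` -/

/-- Jensen over a finite average: `((Σ_x a_x)/N)² ≤ (Σ_x a_x²)/N`. [folklore] -/
theorem sq_avg_le_avg_sq {ι : Type*} [Fintype ι] [Nonempty ι] (a : ι → ℝ) :
    ((∑ x, a x) / Fintype.card ι) ^ 2 ≤ (∑ x, a x ^ 2) / Fintype.card ι := by
  have hN : (0 : ℝ) < Fintype.card ι := by exact_mod_cast Fintype.card_pos
  have h := sq_sum_le_card_mul_sum_sq (s := (Finset.univ : Finset ι)) (f := a)
  rw [Finset.card_univ] at h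
  rw [div_pow, div_le_div_iff₀ (by positivity) hN]
  nlinarith

/-- **The pointwise kinematic bound.**  With `F = flowLift 0 d`, `d_x = flowLiftAt x 0 d`, `|Λ| = #sites`:
`(F(U) − F(V))² ≤ |Λ|⁻¹ Σ_x 4L·(d_x(U) + d_x(V))·Σ_{j<L}(4 − 2Re tr(U_{x_j}V_{x_j}⁻¹))`. [cite: Luscher1983, §2] -/
theorem adjLoop_sub_sq_le (U V : GaugeConfig 3 L SU2) :
    (flowLift 0 (fun u : GaugeConfig 3 1 SU2 => 4 - ((su2Rep (u ((0 : Site 3 1), (0 : Fin 3)))).trace.re) ^ 2) U -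
        flowLift 0 (fun u : GaugeConfig 3 1 SU2 => 4 - ((su2Rep (u ((0 : Site 3 1), (0 : Fin 3)))).trace.re) ^ 2) V) ^ 2 ≤
      (∑ x : Site 3 L, 4 * (L : ℝ) *
        (flowLiftAt x 0 (fun u : GaugeConfig 3 1 SU2 => 4 - ((su2Rep (u ((0 : Site 3 1), (0 : Fin 3)))).trace.re) ^ 2) U +
          flowLiftAt x 0 (fun u : GaugeConfig 3 1 SU2 => 4 - ((su2Rep (u ((0 : Site 3 1), (0 : Fin 3)))).trace.re) ^ 2) V) *
        ∑ j ∈ Finset.range L,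
          (4 - 2 * (((U ((fun z : Site 3 L => z.shift 0)^[j] x, 0) * (V ((fun z : Site 3 L => z.shift 0)^[j] x, 0))⁻¹ : SU2) :
            Matrix (Fin 2) (Fin 2) ℂ).trace.re))) / Fintype.card (Site 3 L) := by
  -- unfold `F` and `d_x`
  have hF : ∀ W : GaugeConfig 3 L SU2,
      flowLift 0 (fun u : GaugeConfig 3 1 SU2 => 4 - ((su2Rep (u ((0 : Site 3 1), (0 : Fin 3)))).trace.re) ^ 2) W =
        (∑ x : Site 3 L, flowLiftAt x 0 (fun u : GaugeConfig 3 1 SU2 =>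
          4 - ((su2Rep (u ((0 : Site 3 1), (0 : Fin 3)))).trace.re) ^ 2) W) / Fintype.card (Site 3 L) := fun W => rfl
  have hd : ∀ (W : GaugeConfig 3 L SU2) (x : Site 3 L),
      flowLiftAt x 0 (fun u : GaugeConfig 3 1 SU2 => 4 - ((su2Rep (u ((0 : Site 3 1), (0 : Fin 3)))).trace.re) ^ 2) W =
        4 - (((lineHolonomy W 0 L x : SU2) : Matrix (Fin 2) (Fin 2) ℂ).trace.re) ^ 2 := by
    intro W x
    simp only [flowLiftAt, wilsonFlow_zero, polyakovSite, fundamentalRep_apply]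
  rw [hF U, hF V, ← sub_div, ← Finset.sum_sub_distrib]
  refine (sq_avg_le_avg_sq _).trans ?_
  refine div_le_div_of_nonneg_right (Finset.sum_le_sum fun x _ => ?_) (Nat.cast_nonneg _)
  rw [hd U x, hd V x]
  have hLip := adjDev_sub_sq_le (lineHolonomy U 0 L x) (lineHolonomy V 0 L x)
  have htel := frobNorm_lineHolonomy_sub_sq_le U V 0 L x
  have hdU : 0 ≤ 4 - (((lineHolonomy U 0 L x : SU2) : Matrix (Fin 2) (Fin 2) ℂ).trace.re) ^ 2 := by
    have h1 := re_trace_le_two (lineHolonomy U 0 L x)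
    have h2 := neg_two_le_re_trace (lineHolonomy U 0 L x)
    nlinarith
  have hdV : 0 ≤ 4 - (((lineHolonomy V 0 L x : SU2) : Matrix (Fin 2) (Fin 2) ℂ).trace.re) ^ 2 := by
    have h1 := re_trace_le_two (lineHolonomy V 0 L x)
    have h2 := neg_two_le_re_trace (lineHolonomy V 0 L x)
    nlinarith
  have hsum0 := add_nonneg hdU hdV
  calc _ ≤ 4 * ((4 - (((lineHolonomy U 0 L x : SU2) : Matrix (Fin 2) (Fin 2) ℂ).trace.re) ^ 2) +
        (4 - (((lineHolonomy V 0 L x : SU2) : Matrix (Fin 2) (Fin 2) ℂ).trace.re) ^ 2)) *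
        frobNorm (((lineHolonomy U 0 L x : SU2) : Matrix (Fin 2) (Fin 2) ℂ) -
          ((lineHolonomy V 0 L x : SU2) : Matrix (Fin 2) (Fin 2) ℂ)) ^ 2 := hLip
    _ ≤ 4 * ((4 - (((lineHolonomy U 0 L x : SU2) : Matrix (Fin 2) (Fin 2) ℂ).trace.re) ^ 2) +
        (4 - (((lineHolonomy V 0 L x : SU2) : Matrix (Fin 2) (Fin 2) ℂ).trace.re) ^ 2)) *
        ((L : ℝ) * ∑ j ∈ Finset.range L,
          (4 - 2 * (((U ((fun z : Site 3 L => z.shift 0)^[j] x, 0) * (V ((fun z : Site 3 L => z.shift 0)^[j] x, 0))⁻¹ : SU2) :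
            Matrix (Fin 2) (Fin 2) ℂ).trace.re))) :=
        mul_le_mul_of_nonneg_left htel (by positivity)
    _ = _ := by ring

/-! ## §3 Integration against the vacuum pair measure -/

/-- `F = flowLift 0 d` is physical (the one-site `d` is continuous, bounded, conjugation- and centre-invariant). [cite: Luscher1983, §2] -/
theorem isPhys_adjLoop : IsPhys (flowLift (L := L) 0 (fun u : GaugeConfig 3 1 SU2 => 4 - ((su2Rep (u ((0 : Site 3 1), (0 : Fin 3)))).trace.re) ^ 2)) := by
  have hd : IsPhys (fun u : GaugeConfig 3 1 SU2 => 4 - ((su2Rep (u ((0 : Site 3 1), (0 : Fin 3)))).trace.re) ^ 2) := by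
    refine isPhys_of_invariant ?_ ⟨4, fun U => ?_⟩ (fun V U => ?_) (fun k U => ?_)
    · have h1 : Continuous fun u : GaugeConfig 3 1 SU2 => su2Rep (u ((0 : Site 3 1), (0 : Fin 3))) :=
        continuous_su2Rep.comp (continuous_apply _)
      exact continuous_const.sub ((Complex.continuous_re.comp h1.matrix_trace).pow 2)
    · have h1 := re_trace_le_two (U ((0 : Site 3 1), (0 : Fin 3)))
      have h2 := neg_two_le_re_trace (U ((0 : Site 3 1), (0 : Fin 3)))
      rw [fundamentalRep_apply, abs_le]
      constructor <;> nlinarith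
    · simp only [map_mul]
      rw [Matrix.trace_mul_cycle, ← map_mul, inv_mul_cancel, map_one, one_mul]
    · dsimp only
      split_ifs with h
      · simp [fundamentalRep_apply]
      · rfl
  exact isPhys_flowLift 0 hd

/-- `d_x = flowLiftAt x 0 d` is physical. [cite: Luscher1983, §2] -/
theorem isPhys_adjLoopAt (x : Site 3 L) : IsPhys (flowLiftAt (L := L) x 0 (fun u : GaugeConfig 3 1 SU2 => 4 - ((su2Rep (u ((0 : Site 3 1), (0 : Fin 3)))).trace.re) ^ 2)) := by
  have hd : IsPhys (fun u : GaugeConfig 3 1 SU2 => 4 - ((su2Rep (u ((0 : Site 3 1), (0 : Fin 3)))).trace.re) ^ 2) := by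
    refine isPhys_of_invariant ?_ ⟨4, fun U => ?_⟩ (fun V U => ?_) (fun k U => ?_)
    · have h1 : Continuous fun u : GaugeConfig 3 1 SU2 => su2Rep (u ((0 : Site 3 1), (0 : Fin 3))) :=
        continuous_su2Rep.comp (continuous_apply _)
      exact continuous_const.sub ((Complex.continuous_re.comp h1.matrix_trace).pow 2)
    · have h1 := re_trace_le_two (U ((0 : Site 3 1), (0 : Fin 3)))
      have h2 := neg_two_le_re_trace (U ((0 : Site 3 1), (0 : Fin 3)))
      rw [fundamentalRep_apply, abs_le]
      constructor <;> nlinarith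
    · simp only [map_mul]
      rw [Matrix.trace_mul_cycle, ← map_mul, inv_mul_cancel, map_one, one_mul]
    · dsimp only
      split_ifs with h
      · simp [fundamentalRep_apply]
      · rfl
  exact isPhys_flowLiftAt x 0 hd

/-- The link factor `p ↦ 4 − 2Re tr(p.1(e) p.2(e)⁻¹)` is measurable and bounded by `8`. [folklore] -/
theorem measurable_linkDefect (e : Edge 3 L) :
    Measurable fun p : GaugeConfig 3 L SU2 × GaugeConfig 3 L SU2 =>
      4 - 2 * (((p.1 e * (p.2 e)⁻¹ : SU2) : Matrix (Fin 2) (Fin 2) ℂ).trace.re) := by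
  haveI : SecondCountableTopology SU2 := secondCountableTopology_su2
  have h1 : Continuous fun p : GaugeConfig 3 L SU2 × GaugeConfig 3 L SU2 => (p.1 e * (p.2 e)⁻¹ : SU2) :=
    ((continuous_apply e).comp continuous_fst).mul ((continuous_apply e).comp continuous_snd).inv
  have h2 : Continuous fun p : GaugeConfig 3 L SU2 × GaugeConfig 3 L SU2 => ((p.1 e * (p.2 e)⁻¹ : SU2) : Matrix (Fin 2) (Fin 2) ℂ) :=
    continuous_subtype_val.comp h1
  exact (continuous_const.sub ((Complex.continuous_re.comp h2.matrix_trace).const_mul _)).measurable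

omit [NeZero L] in
/-- `|4 − 2Re tr(W)| ≤ 8` on `SU(2)`. [folklore] -/
theorem abs_linkDefect_le (W : SU2) : |4 - 2 * ((W : Matrix (Fin 2) (Fin 2) ℂ).trace.re)| ≤ 8 := by
  have h1 := re_trace_le_two W
  have h2 := neg_two_le_re_trace W
  rw [abs_le]; constructor <;> linarith

/-- Integrability of `Ω(U)K_β(U,V)Ω(V)·G(U,V)` for bounded measurable `G` (`β ≥ 0`). [folklore] -/
theorem integrable_pairWeight_mul {β : ℝ} (hβ : 0 ≤ β) {Ω : GaugeConfig 3 L SU2 → ℝ} (hΩ : IsPhys Ω)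
    {G : GaugeConfig 3 L SU2 × GaugeConfig 3 L SU2 → ℝ} (hGm : Measurable G) {C : ℝ} (hGb : ∀ p, |G p| ≤ C) :
    Integrable (fun p : GaugeConfig 3 L SU2 × GaugeConfig 3 L SU2 => Ω p.1 * transferKernel su2Rep β p.1 p.2 * Ω p.2 * G p)
      ((configMeasure SU2 L).prod (configMeasure SU2 L)) := by
  obtain ⟨CΩ, hCΩ⟩ := hΩ.bounded
  have hCΩ0 : 0 ≤ CΩ := (abs_nonneg _).trans (hCΩ (fun _ => 1))
  have hC0 : ∀ p, 0 ≤ C := fun p => (abs_nonneg _).trans (hGb p)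
  refine integrable_latProd ((((hΩ.measurable.comp measurable_fst).mul (measurable_transferKernel_lat β)).mul
    (hΩ.measurable.comp measurable_snd)).mul hGm)
    (C := CΩ * Real.exp (2 * β) ^ Fintype.card (Edge 3 L) * CΩ * C) fun p => ?_
  rw [abs_mul, abs_mul, abs_mul]
  have hK := abs_transferKernel_le_lat hβ p
  exact mul_le_mul (mul_le_mul (mul_le_mul (hCΩ _) hK (abs_nonneg _) hCΩ0) (hCΩ _) (abs_nonneg _) (by positivity))
    (hGb p) (abs_nonneg _) (by positivity)

/-- ★★ **The kinematic Dirichlet chain.**  `β ≥ 0`; `Ω ≥ 0` physical with `K_βΩ = λ₀Ω`; `F = flowLift 0 d`, `d_x = flowLiftAt x 0 d`.  Then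
`λ₀‖FΩ‖² − ⟨FΩ, K_β(FΩ)⟩ ≤ (2L/|Λ|)·Σ_x Σ_{j<L} ∫∫ Ω(U)K_β(U,V)Ω(V)·(d_x(U) + d_x(V))·(4 − 2Re tr(U_{x_j}V_{x_j}⁻¹))`, `x_j = x + j e₀`,
`|Λ| = #Site`.  (Dirichlet identity → Jensen over sites → relative Lipschitz bound of `d` → telescoping + Cauchy–Schwarz along the loop.)
[cite: ReedSimonIV1978, Thm. XIII.1] [cite: Luscher1983, §2] -/
theorem deficit_adjLoop_le_weighted_plaquettes {β : ℝ} (hβ : 0 ≤ β) {Ω : GaugeConfig 3 L SU2 → ℝ} (hΩ : IsPhys Ω)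
    (hΩnn : ∀ U, 0 ≤ Ω U) (heig : transferApply β Ω = topValue su2Rep L β • Ω) :
    topValue su2Rep L β * l2 (fun U => flowLift 0 (fun u : GaugeConfig 3 1 SU2 => 4 - ((su2Rep (u ((0 : Site 3 1), (0 : Fin 3)))).trace.re) ^ 2) U * Ω U) (fun U => flowLift 0 (fun u : GaugeConfig 3 1 SU2 => 4 - ((su2Rep (u ((0 : Site 3 1), (0 : Fin 3)))).trace.re) ^ 2) U * Ω U) -
        qform su2Rep β (fun U => flowLift 0 (fun u : GaugeConfig 3 1 SU2 => 4 - ((su2Rep (u ((0 : Site 3 1), (0 : Fin 3)))).trace.re) ^ 2) U * Ω U) (fun U => flowLift 0 (fun u : GaugeConfig 3 1 SU2 => 4 - ((su2Rep (u ((0 : Site 3 1), (0 : Fin 3)))).trace.re) ^ 2) U * Ω U) ≤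
      (2 * (L : ℝ) / Fintype.card (Site 3 L)) * ∑ x : Site 3 L, ∑ j ∈ Finset.range L,
        ∫ p, Ω p.1 * transferKernel su2Rep β p.1 p.2 * Ω p.2 *
          ((flowLiftAt x 0 (fun u : GaugeConfig 3 1 SU2 => 4 - ((su2Rep (u ((0 : Site 3 1), (0 : Fin 3)))).trace.re) ^ 2) p.1 + flowLiftAt x 0 (fun u : GaugeConfig 3 1 SU2 => 4 - ((su2Rep (u ((0 : Site 3 1), (0 : Fin 3)))).trace.re) ^ 2) p.2) *
            (4 - 2 * (((p.1 ((fun z : Site 3 L => z.shift 0)^[j] x, 0) * (p.2 ((fun z : Site 3 L => z.shift 0)^[j] x, 0))⁻¹ : SU2) :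
              Matrix (Fin 2) (Fin 2) ℂ).trace.re)))
          ∂(configMeasure SU2 L).prod (configMeasure SU2 L) := by
  haveI : SecondCountableTopology SU2 := secondCountableTopology_su2
  set μ2 : Measure (GaugeConfig 3 L SU2 × GaugeConfig 3 L SU2) := (configMeasure SU2 L).prod (configMeasure SU2 L) with hμ2
  have hF : IsPhys (flowLift (L := L) 0 (fun u : GaugeConfig 3 1 SU2 => 4 - ((su2Rep (u ((0 : Site 3 1), (0 : Fin 3)))).trace.re) ^ 2)) := isPhys_adjLoop
  obtain ⟨CF, hCF⟩ := hF.bounded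
  -- the exact Dirichlet identity
  rw [deficit_eq_half_integral_sq β hF.measurable hCF hF.gaugeInv hF.zeroFlux hΩ heig]
  -- the weight and the integrands
  set w : GaugeConfig 3 L SU2 × GaugeConfig 3 L SU2 → ℝ := fun p => Ω p.1 * transferKernel su2Rep β p.1 p.2 * Ω p.2 with hw_def
  have hw0 : ∀ p, 0 ≤ w p := fun p => mul_nonneg (mul_nonneg (hΩnn _) (transferKernel_pos _ _ _ _).le) (hΩnn _)
  -- the summands `T x j`
  have hdx : ∀ x : Site 3 L, IsPhys (flowLiftAt (L := L) x 0 (fun u : GaugeConfig 3 1 SU2 => 4 - ((su2Rep (u ((0 : Site 3 1), (0 : Fin 3)))).trace.re) ^ 2)) := fun x => isPhys_adjLoopAt x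
  have hTint : ∀ (x : Site 3 L) (j : ℕ), Integrable (fun p : GaugeConfig 3 L SU2 × GaugeConfig 3 L SU2 =>
      w p * ((flowLiftAt x 0 (fun u : GaugeConfig 3 1 SU2 => 4 - ((su2Rep (u ((0 : Site 3 1), (0 : Fin 3)))).trace.re) ^ 2) p.1 + flowLiftAt x 0 (fun u : GaugeConfig 3 1 SU2 => 4 - ((su2Rep (u ((0 : Site 3 1), (0 : Fin 3)))).trace.re) ^ 2) p.2) *
        (4 - 2 * (((p.1 ((fun z : Site 3 L => z.shift 0)^[j] x, 0) * (p.2 ((fun z : Site 3 L => z.shift 0)^[j] x, 0))⁻¹ : SU2) :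
          Matrix (Fin 2) (Fin 2) ℂ).trace.re)))) μ2 := by
    intro x j
    obtain ⟨Cd, hCd⟩ := (hdx x).bounded
    have hCd0 : 0 ≤ Cd := (abs_nonneg _).trans (hCd (fun _ => 1))
    refine integrable_pairWeight_mul hβ hΩ
      ((((hdx x).measurable.comp measurable_fst).add ((hdx x).measurable.comp measurable_snd)).mul (measurable_linkDefect _))
      (C := (Cd + Cd) * 8) fun p => ?_
    rw [abs_mul]
    exact mul_le_mul ((abs_add_le _ _).trans (add_le_add (hCd _) (hCd _))) (abs_linkDefect_le _) (abs_nonneg _) (by positivity)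
  -- pointwise: `w (ΔF)² ≤ (4L/|Λ|) Σ_x Σ_j w (d_x + d_x)(link defect)`
  have hpt : ∀ p : GaugeConfig 3 L SU2 × GaugeConfig 3 L SU2,
      Ω p.1 * transferKernel su2Rep β p.1 p.2 * Ω p.2 * (flowLift 0 (fun u : GaugeConfig 3 1 SU2 => 4 - ((su2Rep (u ((0 : Site 3 1), (0 : Fin 3)))).trace.re) ^ 2) p.1 - flowLift 0 (fun u : GaugeConfig 3 1 SU2 => 4 - ((su2Rep (u ((0 : Site 3 1), (0 : Fin 3)))).trace.re) ^ 2) p.2) ^ 2 ≤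
        (4 * (L : ℝ) / Fintype.card (Site 3 L)) * ∑ x : Site 3 L, ∑ j ∈ Finset.range L,
          w p * ((flowLiftAt x 0 (fun u : GaugeConfig 3 1 SU2 => 4 - ((su2Rep (u ((0 : Site 3 1), (0 : Fin 3)))).trace.re) ^ 2) p.1 + flowLiftAt x 0 (fun u : GaugeConfig 3 1 SU2 => 4 - ((su2Rep (u ((0 : Site 3 1), (0 : Fin 3)))).trace.re) ^ 2) p.2) *
            (4 - 2 * (((p.1 ((fun z : Site 3 L => z.shift 0)^[j] x, 0) * (p.2 ((fun z : Site 3 L => z.shift 0)^[j] x, 0))⁻¹ : SU2) :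
              Matrix (Fin 2) (Fin 2) ℂ).trace.re))) := by
    intro p
    have h := mul_le_mul_of_nonneg_left (adjLoop_sub_sq_le (L := L) p.1 p.2) (hw0 p)
    refine (le_of_eq (by rw [hw_def])).trans (h.trans (le_of_eq ?_))
    rw [Finset.sum_div, Finset.mul_sum, Finset.mul_sum]
    refine Finset.sum_congr rfl fun x _ => ?_
    simp only [Finset.mul_sum, Finset.sum_div]
    refine Finset.sum_congr rfl fun j _ => ?_
    ring
  -- integrate
  have hLHSint : Integrable (fun p : GaugeConfig 3 L SU2 × GaugeConfig 3 L SU2 =>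
      Ω p.1 * transferKernel su2Rep β p.1 p.2 * Ω p.2 * (flowLift 0 (fun u : GaugeConfig 3 1 SU2 => 4 - ((su2Rep (u ((0 : Site 3 1), (0 : Fin 3)))).trace.re) ^ 2) p.1 - flowLift 0 (fun u : GaugeConfig 3 1 SU2 => 4 - ((su2Rep (u ((0 : Site 3 1), (0 : Fin 3)))).trace.re) ^ 2) p.2) ^ 2) μ2 := by
    refine integrable_pairWeight_mul hβ hΩ (((hF.measurable.comp measurable_fst).sub (hF.measurable.comp measurable_snd)).pow_const 2)
      (C := (CF + CF) ^ 2) fun p => ?_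
    rw [abs_pow]
    exact pow_le_pow_left₀ (abs_nonneg _) ((abs_sub _ _).trans (add_le_add (hCF _) (hCF _))) 2
  have hRHSint : Integrable (fun p : GaugeConfig 3 L SU2 × GaugeConfig 3 L SU2 =>
      (4 * (L : ℝ) / Fintype.card (Site 3 L)) * ∑ x : Site 3 L, ∑ j ∈ Finset.range L,
        w p * ((flowLiftAt x 0 (fun u : GaugeConfig 3 1 SU2 => 4 - ((su2Rep (u ((0 : Site 3 1), (0 : Fin 3)))).trace.re) ^ 2) p.1 + flowLiftAt x 0 (fun u : GaugeConfig 3 1 SU2 => 4 - ((su2Rep (u ((0 : Site 3 1), (0 : Fin 3)))).trace.re) ^ 2) p.2) *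
          (4 - 2 * (((p.1 ((fun z : Site 3 L => z.shift 0)^[j] x, 0) * (p.2 ((fun z : Site 3 L => z.shift 0)^[j] x, 0))⁻¹ : SU2) :
            Matrix (Fin 2) (Fin 2) ℂ).trace.re)))) μ2 :=
    (integrable_finsetSum _ fun x _ => integrable_finsetSum _ fun j _ => hTint x j).const_mul _
  have hmono := integral_mono hLHSint hRHSint hpt
  rw [integral_const_mul, integral_finsetSum _ (fun x _ => integrable_finsetSum _ fun j _ => hTint x j)] at hmono
  simp_rw [integral_finsetSum _ (fun j _ => hTint _ j)] at hmono
  have hL0 : (0 : ℝ) ≤ 2 * (L : ℝ) / Fintype.card (Site 3 L) := by positivity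
  calc (1 / 2 : ℝ) * ∫ p, Ω p.1 * transferKernel su2Rep β p.1 p.2 * Ω p.2 * (flowLift 0 (fun u : GaugeConfig 3 1 SU2 => 4 - ((su2Rep (u ((0 : Site 3 1), (0 : Fin 3)))).trace.re) ^ 2) p.1 - flowLift 0 (fun u : GaugeConfig 3 1 SU2 => 4 - ((su2Rep (u ((0 : Site 3 1), (0 : Fin 3)))).trace.re) ^ 2) p.2) ^ 2 ∂μ2
      ≤ (1 / 2 : ℝ) * ((4 * (L : ℝ) / Fintype.card (Site 3 L)) * ∑ x : Site 3 L, ∑ j ∈ Finset.range L,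
          ∫ p, w p * ((flowLiftAt x 0 (fun u : GaugeConfig 3 1 SU2 => 4 - ((su2Rep (u ((0 : Site 3 1), (0 : Fin 3)))).trace.re) ^ 2) p.1 + flowLiftAt x 0 (fun u : GaugeConfig 3 1 SU2 => 4 - ((su2Rep (u ((0 : Site 3 1), (0 : Fin 3)))).trace.re) ^ 2) p.2) *
            (4 - 2 * (((p.1 ((fun z : Site 3 L => z.shift 0)^[j] x, 0) * (p.2 ((fun z : Site 3 L => z.shift 0)^[j] x, 0))⁻¹ : SU2) :
              Matrix (Fin 2) (Fin 2) ℂ).trace.re))) ∂μ2) := mul_le_mul_of_nonneg_left hmono (by norm_num)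
    _ = _ := by rw [hw_def]; ring

end Summit.QuantumFields.YangMills.Theorems.AdjointLoopFano

end
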